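import Literature.Combinatorics.SimpleGraph.HypercubeParkingFunctions
import HarnessLib

/-!
# The parking functions dominated by a given one: `dom(f)` has `∏_{v ≠ q} (f(v) + 1)` elements
# (Benson–Chakrabarty–Tetali 2010, Definition 2.2 and Proposition 2.2 (a); the count behind
# Theorem 5.2)

Source (held, read at the page; statements VERBATIM). B. Benson, D. Chakrabarty, P. Tetali,
*`G`-parking functions, acyclic orientations and spanning trees*, Discrete Math. 310 (2010)
1340–1353 [BensonChakrabartyTetali2010] (held text `paper:arxiv-0801.1114`, chunks p0004 and
p0015): «**Definition 2.2.** Given two parking functions `f, g ∈ 𝒫(G,q)`, we say `g ≺ f`, if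
`g(v) ≤ f(v)`, for all `v ∈ V`. […] For `f ∈ 𝒫(G,q)`, let `‖f‖ := Σ_v f(v)`, and
`dom(f) = {g ∈ 𝒫(G,q) : g ≺ f}`. […] **Proposition 2.2.** (a) If `f ∈ 𝒫(G,q)` and
`g : V(G) → ℤ`, `g(q) = −1`, with `0 ≤ g(v) ≤ f(v)` (for all `v`), then `g ∈ 𝒫(G,q)` and
`g ∈ dom(f)`.» — hence `dom(f)` is the box `{g : g(q) = −1, 0 ≤ g(v) ≤ f(v) for v ≠ q}` — and
§5.2, **Theorem 5.2**: «Let `f^n` denote the canonical `Q_n`-parking function. Then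
`f^n(v) = wgt(v) − 1 […]. Consequently, if `f` is semi-canonical, then
`|dom(f)| = ∏_{k=2}^{n} k^{\binom{n}{k}}`.»

## What is formalised (vocabulary: `IsReduced G q D` of `ReducedDivisors`; parking functions
## carry `f(q) = −1`; `IsReduced.of_le` of `ParkingFunctionsAcyclicOrientations` is
## Proposition 2.2 (a))

* `isReduced_and_le_iff` — `dom(f)` is the box of Proposition 2.2 (a);
* **`card_dom_eq_prod`** — `|dom(f)| = ∏_{v ≠ q} (f(v) + 1)`, the counting step used in
  Theorem 5.2;
* **Proposition 2.2 (b)** `setOf_dom_inf` (`dom(f ∧ g) = dom(f) ∩ dom(g)`; `f ∧ g ∈ 𝒫(G,q)` is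
  `IsReduced.inf` of `ParkingFunctionsAcyclicOrientations`);
* **`𝒫(G,q) = ⋃_i dom(g_i)`** over the maximum parking functions `g_i` («every non-maximal
  parking function is dominated by some maximal parking function», with Corollary 3.2):
  `isReduced_iff_exists_maximum_ge` and the set identity `setOf_isReduced_eq_iUnion_dom`;
* for the `n`-cube and `f = wgt − 1` (`HypercubeParkingFunctions`): `card_filter_weight_eq_choose`
  (`\binom{n}{k}` vertices of weight `k`), `prod_weight_eq_prod_pow_choose`
  (`∏_{v ≠ 0} wgt(v) = ∏_{k=1}^{n} k^{\binom{n}{k}}`) and **Theorem 5.2's consequence**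
  **`card_dom_hypercube_weight_sub_one`**: `|dom(wgt − 1)| = ∏_{k=1}^{n} k^{\binom{n}{k}}`
  (`= ∏_{k=2}^{n} k^{\binom{n}{k}}`, the factor `k = 1` being `1`).

Theorems only; no `sorry`; no named facts.
-/

open Finset SimpleGraph

namespace Literature.Combinatorics.SimpleGraph.BakerNorine

variable {V : Type*} [Fintype V] [DecidableEq V] {G : SimpleGraph V} [DecidableRel G.Adj]

/-- **`dom(f)` is a box** (Proposition 2.2 (a) and its trivial converse): for a parking function
`f`, a function `g` with `g(q) = −1` is a parking function dominated by `f` iff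
`0 ≤ g(v) ≤ f(v)` for all `v ≠ q`. [cite: BensonChakrabartyTetali2010, Proposition 2.2 (a)] -/
theorem isReduced_and_le_iff {q : V} {f g : V → ℤ} (hf : IsReduced G q f) (hfq : f q = -1)
    (hgq : g q = -1) : IsReduced G q g ∧ g ≤ f ↔ ∀ v, v ≠ q → 0 ≤ g v ∧ g v ≤ f v := by
  constructor
  · rintro ⟨hg, hle⟩ v hv
    exact ⟨hg.nonneg hv, hle v⟩
  · intro h
    refine ⟨hf.of_le (fun v hv => (h v hv).1) fun v hv => (h v hv).2, fun v => ?_⟩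
    by_cases hv : v = q
    · rw [hv, hfq, hgq]
    · exact (h v hv).2

/-- **`|dom(f)| = ∏_{v ≠ q} (f(v) + 1)`**: the parking functions `g ≺ f` (with `g(q) = −1`)
correspond to the choices `0 ≤ g(v) ≤ f(v)` at each `v ≠ q` — the count behind «Consequently,
if `f` is semi-canonical, then `|dom(f)| = ∏_{k=2}^n k^{\binom{n}{k}}`».
[cite: BensonChakrabartyTetali2010, Theorem 5.2 (proof) with Proposition 2.2 (a)] -/
theorem card_dom_eq_prod {q : V} {f : V → ℤ} (hf : IsReduced G q f) (hfq : f q = -1) :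
    Nat.card {g : V → ℤ // IsReduced G q g ∧ g q = -1 ∧ g ≤ f} =
      ∏ v ∈ univ.erase q, (f v + 1).toNat := by
  -- the box `∏_{v ≠ q} {0, …, f v}`
  have hfnn : ∀ v, v ≠ q → 0 ≤ f v := fun v hv => hf.nonneg hv
  have key : Nat.card {g : V → ℤ // IsReduced G q g ∧ g q = -1 ∧ g ≤ f} =
      Nat.card ((v : {v // v ≠ q}) → Fin (f v + 1).toNat) := by
    refine Nat.card_congr
      { toFun := fun g v => ⟨(g.1 v).toNat, ?_⟩
        invFun := fun h => ⟨fun v => if hv : v = q then -1 else ((h ⟨v, hv⟩ : ℕ) : ℤ), ?_⟩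
        left_inv := fun g => ?_
        right_inv := fun h => ?_ }
    · -- `0 ≤ g v ≤ f v` gives `(g v).toNat < (f v + 1).toNat`
      have h1 : 0 ≤ g.1 v := g.2.1.nonneg v.2
      have h2 : g.1 v ≤ f v := g.2.2.2 v
      have h3 : ((g.1 v.1).toNat : ℤ) = g.1 v := Int.toNat_of_nonneg h1
      have h4 : (((f v.1 + 1).toNat : ℕ) : ℤ) = f v + 1 := Int.toNat_of_nonneg (by omega)
      omega
    · -- the box element is a parking function dominated by `f`
      have hgq : (fun v => if hv : v = q then (-1 : ℤ) else ((h ⟨v, hv⟩ : ℕ) : ℤ)) q = -1 := by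
        simp
      refine ⟨((isReduced_and_le_iff hf hfq hgq).2 fun v hv => ?_).1, hgq,
        ((isReduced_and_le_iff hf hfq hgq).2 fun v hv => ?_).2⟩ <;>
      · simp only [dif_neg hv]
        refine ⟨Nat.cast_nonneg _, ?_⟩
        have h1 : ((h ⟨v, hv⟩ : ℕ) : ℤ) < (((f v + 1).toNat : ℕ) : ℤ) := by
          exact_mod_cast (h ⟨v, hv⟩).2
        have h4 : (((f v + 1).toNat : ℕ) : ℤ) = f v + 1 := Int.toNat_of_nonneg (by
          have := hfnn v hv; omega)
        omega
    · -- left inverse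
      apply Subtype.ext
      funext v
      dsimp only
      by_cases hv : v = q
      · rw [dif_pos hv, hv, g.2.2.1]
      · rw [dif_neg hv]
        exact Int.toNat_of_nonneg (g.2.1.nonneg hv)
    · -- right inverse
      funext v
      apply Fin.ext
      dsimp only
      rw [dif_neg v.2, Int.toNat_natCast]
  rw [key, Nat.card_pi]
  simp only [Nat.card_eq_fintype_card, Fintype.card_fin]
  exact (Finset.prod_subtype (univ.erase q) (fun v => by simp) fun v => (f v + 1).toNat).symm

/-! ### Proposition 2.2 (b): `dom(f ∧ g) = dom(f) ∩ dom(g)` -/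

section Inf

/-- **Proposition 2.2 (b).** «If `f, g ∈ 𝒫(G,q)`, then `f ∧ g ∈ 𝒫(G,q)` and
`dom(f ∧ g) = dom(f) ∩ dom(g)`» (`f ∧ g (v) = min {f(v), g(v)}` is `f ⊓ g`; the first assertion
is `IsReduced.inf`). [cite: BensonChakrabartyTetali2010, Proposition 2.2 (b)] -/
theorem setOf_dom_inf (q : V) (f g : V → ℤ) :
    {D : V → ℤ | IsReduced G q D ∧ D q = -1 ∧ D ≤ f ⊓ g} =
      {D : V → ℤ | IsReduced G q D ∧ D q = -1 ∧ D ≤ f} ∩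
        {D : V → ℤ | IsReduced G q D ∧ D q = -1 ∧ D ≤ g} := by
  ext D
  simp only [Set.mem_setOf_eq, Set.mem_inter_iff, le_inf_iff]
  tauto

end Inf

/-! ### `𝒫(G,q)` is covered by the `dom` of the maximum parking functions -/

section Cover

/-- «Every non-maximal parking function is dominated by some maximal parking function»; with
Corollary 3.2 (maximal = maximum): a function `D` with `D(q) = −1` is a `G`-parking function iff
`0 ≤ D` off `q` and `D ≺ f` for some MAXIMUM parking function `f` (`deg f = g − 1`).
[cite: BensonChakrabartyTetali2010, §3 (after Corollary 3.3: «𝒫(G) = ∪_{i=1}^k dom(g_i)»)] -/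
theorem isReduced_iff_exists_maximum_ge {q : V} {D : V → ℤ} (hDq : D q = -1) :
    IsReduced G q D ↔ (∀ v, v ≠ q → 0 ≤ D v) ∧
      ∃ f : V → ℤ, (IsReduced G q f ∧ f q = -1 ∧ ∑ v, f v = genus G - 1) ∧ D ≤ f := by
  constructor
  · intro hD
    obtain ⟨ρ, -, -, hle, hred, hq, hsum⟩ := hD.exists_le_orderDivisor_isReduced
    refine ⟨fun v hv => hD.nonneg hv, orderDivisor G ρ, ⟨hred, hq, ?_⟩, fun v => ?_⟩
    · rw [← Finset.add_sum_erase _ _ (mem_univ q), hq, hsum]; ring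
    · by_cases hv : v = q
      · rw [hv, hDq, hq]
      · exact hle v hv
  · rintro ⟨h0, f, ⟨hf, -, -⟩, hle⟩
    exact hf.of_le h0 fun v _ => hle v

/-- **`𝒫(G,q) = ⋃_{i} dom(g_i)`**, the union over the maximum `G`-parking functions `g_i`.
[cite: BensonChakrabartyTetali2010, §3 (after Corollary 3.3)] -/
theorem setOf_isReduced_eq_iUnion_dom (q : V) :
    {D : V → ℤ | IsReduced G q D ∧ D q = -1} =
      ⋃ f ∈ {f : V → ℤ | IsReduced G q f ∧ f q = -1 ∧ ∑ v, f v = genus G - 1},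
        {D : V → ℤ | IsReduced G q D ∧ D q = -1 ∧ D ≤ f} := by
  ext D
  simp only [Set.mem_setOf_eq, Set.mem_iUnion, exists_prop]
  constructor
  · rintro ⟨hD, hDq⟩
    obtain ⟨-, f, hf, hle⟩ := (isReduced_iff_exists_maximum_ge hDq).1 hD
    exact ⟨f, hf, hD, hDq, hle⟩
  · rintro ⟨f, -, hD, hDq, -⟩
    exact ⟨hD, hDq⟩

end Cover

/-! ### The `n`-cube: `|dom(wgt − 1)| = ∏_k k^{\binom{n}{k}}` -/

section Cube

variable {n : ℕ}

/-- There are `\binom{n}{k}` binary vectors of length `n` and Hamming weight `k`. [folklore] -/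
private theorem card_filter_weight_eq_choose (k : ℕ) :
    #{v : Fin n → Bool | weight v = k} = n.choose k := by
  have h : #{v : Fin n → Bool | weight v = k} = #(powersetCard k (univ : Finset (Fin n))) := by
    refine card_nbij' (fun v => univ.filter fun i => v i = true) (fun s i => decide (i ∈ s))
      (fun v hv => ?_) (fun s hs => ?_) (fun v _ => ?_) (fun s _ => ?_)
    · have hv' : weight v = k := (mem_filter.1 (mem_coe.1 hv)).2
      rw [mem_coe, mem_powersetCard]
      exact ⟨subset_univ _, by rw [← hv', weight_apply]⟩
    · have hs' := (mem_powersetCard.1 (mem_coe.1 hs)).2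
      rw [mem_coe, mem_filter, weight_apply]
      refine ⟨mem_univ _, ?_⟩
      rw [← hs']
      congr 1
      ext i
      simp
    · funext i
      simp
    · ext i
      simp
  rw [h, card_powersetCard, card_univ, Fintype.card_fin]

/-- `∏_{v ≠ 0} wgt(v) = ∏_{k=1}^{n} k^{\binom{n}{k}}` (grouping the vertices of `Q_n` by weight).
[cite: BensonChakrabartyTetali2010, Theorem 5.2 (proof)] -/
theorem prod_weight_eq_prod_pow_choose :
    ∏ v ∈ univ.erase (fun _ : Fin n => false), weight v = ∏ k ∈ Icc 1 n, k ^ n.choose k := by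
  have hmaps : ∀ v ∈ univ.erase (fun _ : Fin n => false), weight v ∈ Icc 1 n := by
    intro v hv
    rw [mem_Icc, weight_apply]
    refine ⟨card_pos.2 ?_, (card_le_univ _).trans (by rw [Fintype.card_fin])⟩
    by_contra hne
    rw [Finset.not_nonempty_iff_eq_empty, filter_eq_empty_iff] at hne
    exact (mem_erase.1 hv).1 (funext fun i => by simpa using hne (mem_univ i))
  rw [← prod_fiberwise_of_maps_to hmaps]
  refine prod_congr rfl fun k hk => ?_
  rw [prod_congr rfl fun v hv => (mem_filter.1 hv).2, prod_const]
  congr 1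
  -- the fibre over `k ≥ 1` inside `V \ {0}` is the whole weight-`k` level
  rw [← card_filter_weight_eq_choose k]
  congr 1
  ext v
  simp only [mem_filter, mem_erase, mem_univ, true_and, and_true]
  constructor
  · exact fun h => h.2
  · intro hv
    refine ⟨fun h0 => ?_, hv⟩
    rw [h0, weight_apply] at hv
    simp only [Bool.false_eq_true, Finset.filter_false, card_empty] at hv
    rw [mem_Icc] at hk
    omega

variable [DecidableRel (hypercube n).Adj]

/-- **Theorem 5.2, the consequence**: «if `f` is semi-canonical, then
`|dom(f)| = ∏_{k=2}^n k^{\binom{n}{k}}`» — for the canonical `f = wgt − 1` on `Q_n`, the parking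
functions `g ≺ f` number `∏_{k=1}^{n} k^{\binom{n}{k}}`.
[cite: BensonChakrabartyTetali2010, Theorem 5.2] -/
theorem card_dom_hypercube_weight_sub_one :
    Nat.card {g : (Fin n → Bool) → ℤ // IsReduced (hypercube n) (fun _ => false) g ∧
        g (fun _ => false) = -1 ∧ g ≤ fun v => (weight v : ℤ) - 1} =
      ∏ k ∈ Icc 1 n, k ^ n.choose k := by
  rw [card_dom_eq_prod isReduced_hypercube_weight_sub_one weight_sub_one_apply_zero,
    ← prod_weight_eq_prod_pow_choose]
  refine prod_congr rfl fun v _ => ?_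
  rw [sub_add_cancel, Int.toNat_natCast]

end Cube

end Literature.Combinatorics.SimpleGraph.BakerNorine
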